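import Summits.MatrixMultiplication.MatrixMultiplication.Theorems.SoloInformedValPairPacking

/-!
# SoloInformedValHubLemmas — avoidance inequalities at a universal vertex

Solo-informed programme (MatrixMultiplication, side question on the value of trapezoid-free triples), gen 79.

Setting (as in `SoloInformedValInducedMatching`, `SoloInformedValPairPacking`, `SoloInformedValNestedPacking`):
an abelian group `G`, potentials `x : I → G`, `y : J → G`, `z : K → G`, pair graphs `H_IJ, H_JK, H_KI`, and the
hypothesis `NoAccidental`.  Write `B = {y j - z k : (j, k) ∈ H_JK}` for the set of all `JK`-labels.

The first open case of the two-step local packing question asks whether a vertex `i₀` that is `H_IJ`-adjacent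
to EVERY `J`-vertex (a `J`-universal hub) forces at most `|G|` triangles.  This file records the two elementary
avoidance facts such a hub provides, each of the form "a translate of `B` misses a set of potentials / labels".

## Results

* `NoAccidental.sum_ne_zero_of_fst_ne` — the basic pointwise fact: for edges `(i, j') ∈ H_IJ`, `(j, k) ∈ H_JK`,
  `(k', i') ∈ H_KI` with `i ≠ i'` the alternating sum `(x i - y j') + (y j - z k) + (z k' - x i')` is non-zero.
* `NoAccidental.card_labelsJK_add_card_le_of_hub` — (H1): if `i₀` is adjacent to every `J`-vertex, `y` is
  injective and some `KI`-edge `(k', i')` has `i' ≠ i₀`, then `|B| + |J| ≤ |G|`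
  (the translate `B + (z k' - x i' + x i₀)` misses every potential `y j'`).
* `NoAccidental.card_labelsJK_add_card_hubK_le` — (H2): if some `IJ`-edge `(i', j')` has `i' ≠ i₀`, then
  `|B| + |{z κ : (κ, i₀) ∈ H_KI}| ≤ |G|` (the translate `B + (x i' - y j' - x i₀)` misses `-z κ` for every
  `K`-neighbour `κ` of `i₀`).
* `NoAccidental.card_labelsIJ_off_add_card_labelsJK_le` — (H2'): if `(κ, i₀) ∈ H_KI` for some `κ`, then
  `|{x i' - y j' : (i', j') ∈ H_IJ, i' ≠ i₀}| + |B| ≤ |G|` (the set `-(A' + (z κ - x i₀))` of shifted negated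
  off-hub `IJ`-labels misses `B`).

In each case the excluded coincidence is literally an accidental solution with outer `I`-indices `i₀ ≠ i'`
(or `i' ≠ i₀`), so `NoAccidental` forbids it; the inequality is then `|translate| + |other set| = |union| ≤ |G|`.
Together with nested packing (`SoloInformedValNestedPacking`: `t_i + |B| ≤ |G|` for every other `I`-vertex `i`)
these are the counting constraints under which a hub configuration with more than `|G|` triangles would have to
live.
-/

namespace Summit.MatrixMultiplication.MatrixMultiplication.Theorems.SoloVal

variable {G : Type*} [AddCommGroup G]
variable {I J K : Type*}
variable {x : I → G} {y : J → G} {z : K → G}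
variable {HIJ : Finset (I × J)} {HJK : Finset (J × K)} {HKI : Finset (K × I)}

/-- The pointwise fact behind every hub inequality: an alternating sum over an `IJ`-, a `JK`- and a `KI`-edge
whose two `I`-ends differ cannot vanish. -/
theorem NoAccidental.sum_ne_zero_of_fst_ne (hN : NoAccidental x y z HIJ HJK HKI) {i i' : I} (hne : i ≠ i')
    {j j' : J} {k k' : K} (h1 : (i, j') ∈ HIJ) (h2 : (j, k) ∈ HJK) (h3 : (k', i') ∈ HKI) :
    (x i - y j') + (y j - z k) + (z k' - x i') ≠ 0 :=
  fun h => hne (hN i j' j k k' i' h1 h2 h3 h).1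

/-- (H1)  A `J`-universal hub `i₀`, injective `J`-potentials and one `KI`-edge `(k', i')` with `i' ≠ i₀` give
`|B| + |J| ≤ |G|`. -/
theorem NoAccidental.card_labelsJK_add_card_le_of_hub [Fintype G] [DecidableEq G] [Fintype J]
    (hN : NoAccidental x y z HIJ HJK HKI) (hy : Function.Injective y) {i₀ i' : I} (hne : i₀ ≠ i')
    (hub : ∀ j, (i₀, j) ∈ HIJ) {k' : K} (h3 : (k', i') ∈ HKI) :
    (HJK.image (fun e : J × K => y e.1 - z e.2)).card + Fintype.card J ≤ Fintype.card G := by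
  set c : G := z k' - x i' + x i₀ with hc
  set Bs : Finset G := (HJK.image (fun e : J × K => y e.1 - z e.2)).image (fun g => g + c) with hBs
  have hB : Bs.card = (HJK.image (fun e : J × K => y e.1 - z e.2)).card :=
    Finset.card_image_of_injective _ (add_left_injective c)
  have hY : (Finset.univ.image y).card = Fintype.card J := by
    rw [Finset.card_image_of_injective _ hy, Finset.card_univ]
  have hdisj : Disjoint Bs (Finset.univ.image y) := by
    rw [Finset.disjoint_left]
    intro g hg hg'
    obtain ⟨b, hb, hgb⟩ := Finset.mem_image.mp hg
    obtain ⟨⟨j, k⟩, he, hbe⟩ := Finset.mem_image.mp hb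
    obtain ⟨j', -, hj'⟩ := Finset.mem_image.mp hg'
    simp only at hbe
    apply hN.sum_ne_zero_of_fst_ne hne (hub j') he h3
    calc (x i₀ - y j') + (y j - z k) + (z k' - x i') = (y j - z k) + c - y j' := by rw [hc]; abel
      _ = 0 := by rw [hbe, hgb, ← hj', sub_self]
  calc (HJK.image (fun e : J × K => y e.1 - z e.2)).card + Fintype.card J
      = Bs.card + (Finset.univ.image y).card := by rw [hB, hY]
    _ = (Bs ∪ Finset.univ.image y).card := (Finset.card_union_of_disjoint hdisj).symm
    _ ≤ Fintype.card G := Finset.card_le_univ _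

/-- (H2)  One `IJ`-edge `(i', j')` off the vertex `i₀` gives `|B| + |{z κ : (κ, i₀) ∈ H_KI}| ≤ |G|`. -/
theorem NoAccidental.card_labelsJK_add_card_hubK_le [Fintype G] [DecidableEq G] [DecidableEq I]
    (hN : NoAccidental x y z HIJ HJK HKI) {i₀ i' : I} (hne : i' ≠ i₀) {j' : J} (h1 : (i', j') ∈ HIJ) :
    (HJK.image (fun e : J × K => y e.1 - z e.2)).card
      + ((HKI.filter (fun e : K × I => e.2 = i₀)).image (fun e : K × I => - z e.1)).card ≤ Fintype.card G := by
  set c : G := x i' - y j' - x i₀ with hc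
  set Bs : Finset G := (HJK.image (fun e : J × K => y e.1 - z e.2)).image (fun g => g + c) with hBs
  have hB : Bs.card = (HJK.image (fun e : J × K => y e.1 - z e.2)).card :=
    Finset.card_image_of_injective _ (add_left_injective c)
  have hdisj : Disjoint Bs ((HKI.filter (fun e : K × I => e.2 = i₀)).image (fun e : K × I => - z e.1)) := by
    rw [Finset.disjoint_left]
    intro g hg hg'
    obtain ⟨b, hb, hgb⟩ := Finset.mem_image.mp hg
    obtain ⟨⟨j, k⟩, he, hbe⟩ := Finset.mem_image.mp hb
    obtain ⟨⟨κ, i₁⟩, hκ, hgκ⟩ := Finset.mem_image.mp hg'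
    rw [Finset.mem_filter] at hκ
    obtain ⟨hκ, hi₁⟩ := hκ
    simp only at hbe hgκ hi₁
    subst hi₁
    apply hN.sum_ne_zero_of_fst_ne hne h1 he hκ
    calc (x i' - y j') + (y j - z k) + (z κ - x i₁) = (y j - z k) + c - (- z κ) := by rw [hc]; abel
      _ = 0 := by rw [hbe, hgb, ← hgκ, sub_self]
  calc (HJK.image (fun e : J × K => y e.1 - z e.2)).card
        + ((HKI.filter (fun e : K × I => e.2 = i₀)).image (fun e : K × I => - z e.1)).card
      = Bs.card + ((HKI.filter (fun e : K × I => e.2 = i₀)).image (fun e : K × I => - z e.1)).card := by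
        rw [hB]
    _ = (Bs ∪ (HKI.filter (fun e : K × I => e.2 = i₀)).image (fun e : K × I => - z e.1)).card :=
        (Finset.card_union_of_disjoint hdisj).symm
    _ ≤ Fintype.card G := Finset.card_le_univ _

/-- (H2')  One `KI`-edge `(κ, i₀)` at the vertex `i₀` gives
`|{x i' - y j' : (i', j') ∈ H_IJ, i' ≠ i₀}| + |B| ≤ |G|`. -/
theorem NoAccidental.card_labelsIJ_off_add_card_labelsJK_le [Fintype G] [DecidableEq G] [DecidableEq I]
    (hN : NoAccidental x y z HIJ HJK HKI) {i₀ : I} {κ : K} (h3 : (κ, i₀) ∈ HKI) :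
    ((HIJ.filter (fun e : I × J => e.1 ≠ i₀)).image (fun e : I × J => x e.1 - y e.2)).card
      + (HJK.image (fun e : J × K => y e.1 - z e.2)).card ≤ Fintype.card G := by
  set c : G := z κ - x i₀ with hc
  set As : Finset G :=
    ((HIJ.filter (fun e : I × J => e.1 ≠ i₀)).image (fun e : I × J => x e.1 - y e.2)).image
      (fun g => -(g + c)) with hAs
  have hA : As.card = ((HIJ.filter (fun e : I × J => e.1 ≠ i₀)).image (fun e : I × J => x e.1 - y e.2)).card :=
    Finset.card_image_of_injective _ (neg_injective.comp (add_left_injective c))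
  have hdisj : Disjoint As (HJK.image (fun e : J × K => y e.1 - z e.2)) := by
    rw [Finset.disjoint_left]
    intro g hg hg'
    obtain ⟨a, ha, hga⟩ := Finset.mem_image.mp hg
    obtain ⟨⟨i', j'⟩, he1, hae⟩ := Finset.mem_image.mp ha
    rw [Finset.mem_filter] at he1
    obtain ⟨he1, hi'⟩ := he1
    obtain ⟨⟨j, k⟩, he, hbe⟩ := Finset.mem_image.mp hg'
    simp only at hae hbe hi'
    apply hN.sum_ne_zero_of_fst_ne hi' he1 he h3
    calc (x i' - y j') + (y j - z k) + (z κ - x i₀) = (y j - z k) - (-( (x i' - y j') + c)) := by rw [hc]; abel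
      _ = 0 := by rw [hae, hga, hbe, sub_self]
  calc ((HIJ.filter (fun e : I × J => e.1 ≠ i₀)).image (fun e : I × J => x e.1 - y e.2)).card
        + (HJK.image (fun e : J × K => y e.1 - z e.2)).card
      = As.card + (HJK.image (fun e : J × K => y e.1 - z e.2)).card := by rw [hA]
    _ = (As ∪ HJK.image (fun e : J × K => y e.1 - z e.2)).card :=
        (Finset.card_union_of_disjoint hdisj).symm
    _ ≤ Fintype.card G := Finset.card_le_univ _

end Summit.MatrixMultiplication.MatrixMultiplication.Theorems.SoloVal
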